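import Mathlib.Data.Nat.Choose.Basic
import Mathlib.Algebra.BigOperators.Intervals
import Mathlib.Algebra.Order.BigOperators.Group.Finset
import Mathlib.Tactic
import Summits.CriticalPhenomena.PercolationContinuityZ3.Theorems.PercNearOneGluingNoHeavyLowerTailLemmaS
import HarnessLib

/-!
# Lemma S with outward propagation of negativity in place of two-level monotonicity

Support file for the Sahi / Conjecture-P programme of route `PercNearOneGluingNoHeavy`
(`--supports stmt-CriticalPhenomena-4575`, prover prim-l12-p5 gen 28; proof note
`prim-l12-p5/U-PROOF-g28.md` §5).  No definitions, no named facts, no sorries.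

`LemmaS.window_nonneg` / `LemmaS.lemma_S` derive the nonnegativity of all centred-window sums (and then of
all symmetric-unimodal-tilted sums, by `Shells.abel_window`) of `a(x) = C(M₂,x)·Φ(x)`,
`Φ(x) = κF₁(K-x) + (2x-M₂)Mo₁(K-x)`, from the nonnegativity of the full sum and the two-level monotonicity
(TLM) of `(F₁, Mo₁)`.  Their proofs use TLM only through `LemmaS.val_nonpos_after`: a strictly negative shell
value at a level `b₀` above the centre forces nonpositive shell values at all levels `b ≥ b₀`.  Here the two
statements are re-proved with exactly this OUTWARD PROPAGATION OF NEGATIVITY as the hypothesis (`hNP`):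
`window_nonneg'`, `lemma_S'`.  `…OneBlock` establishes `hNP` for an untilted partner block in every regime,
where TLM fails.
-/

namespace Summit.CriticalPhenomena.PercolationContinuityZ3.Theorems

namespace LemmaSNP

open Finset

variable (M₂ K : ℕ) (κ : ℝ) (F₁ Mo₁ : ℕ → ℝ)

/-- `LemmaS.window_nonneg` with two-level monotonicity replaced by outward propagation of negativity. -/
theorem window_nonneg' (n₁ j : ℕ) (hN : 2 * K + j = n₁ + M₂) (hκ : 0 ≤ κ)
    (hFz : ∀ k, n₁ < k → F₁ k = 0) (hFpos : ∀ k, k ≤ n₁ → 0 < F₁ k)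
    (hMoz : ∀ k, n₁ < k → Mo₁ k = 0)
    (hFsym : ∀ k, k ≤ n₁ → F₁ (n₁ - k) = F₁ k) (hMoodd : ∀ k, k ≤ n₁ → Mo₁ (n₁ - k) = -Mo₁ k)
    (hNP : ∀ b₀ : ℕ, (n₁ : ℝ) ≤ 2 * (b₀ : ℝ) + j →
      κ * (F₁ b₀ + F₁ (b₀ + j)) < (2 * (b₀ : ℝ) + j - n₁) * (Mo₁ b₀ + Mo₁ (b₀ + j)) →
      ∀ b, b₀ ≤ b → κ * (F₁ b + F₁ (b + j)) - (2 * (b : ℝ) + j - n₁) * (Mo₁ b + Mo₁ (b + j)) ≤ 0)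
    (htot : 0 ≤ ∑ x ∈ range (M₂ + 1), (if 0 ≤ x ∧ x ≤ M₂ - 0 then (M₂.choose x : ℝ) *
        (if x ≤ K then κ * F₁ (K - x) + (2 * (x : ℝ) - M₂) * Mo₁ (K - x) else 0) else 0))
    (i : ℕ) :
    0 ≤ ∑ x ∈ range (M₂ + 1), (if i ≤ x ∧ x ≤ M₂ - i then (M₂.choose x : ℝ) *
        (if x ≤ K then κ * F₁ (K - x) + (2 * (x : ℝ) - M₂) * Mo₁ (K - x) else 0) else 0) := by
  rcases le_or_gt 0 (∑ x ∈ range (M₂ + 1), (if i ≤ x ∧ x ≤ M₂ - i then (M₂.choose x : ℝ) *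
        (if x ≤ K then κ * F₁ (K - x) + (2 * (x : ℝ) - M₂) * Mo₁ (K - x) else 0) else 0)) with h | h
  · exact h
  · exfalso
    obtain ⟨i', hii', hlt, hiK, hval⟩ :=
      LemmaS.exists_neg_shell M₂ K κ F₁ Mo₁ n₁ j hN hκ hFz hFpos hMoz hFsym hMoodd (M₂ + 1 - i) i le_rfl h
    have hVeq : ((M₂ : ℝ) - 2 * i') = 2 * ((K - i' : ℕ) : ℝ) + j - n₁ := by
      have e : ((2 * K + j : ℕ) : ℝ) = ((n₁ + M₂ : ℕ) : ℝ) := by rw [hN]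
      push_cast [Nat.cast_sub hiK] at e ⊢
      linarith
    have hV : (n₁ : ℝ) ≤ 2 * ((K - i' : ℕ) : ℝ) + j := by
      have : (0 : ℝ) ≤ (M₂ : ℝ) - 2 * i' := by
        have : ((2 * i' : ℕ) : ℝ) ≤ (M₂ : ℝ) := by exact_mod_cast hlt.le
        push_cast at this
        linarith
      linarith
    rw [hVeq] at hval
    have hneg : κ * (F₁ (K - i') + F₁ (K - i' + j)) <
        (2 * ((K - i' : ℕ) : ℝ) + j - n₁) * (Mo₁ (K - i') + Mo₁ (K - i' + j)) := by linarith
    have hshells : ∀ i'' ∈ range i, ∑ x ∈ range (M₂ + 1),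
        (if (x = i'' ∨ x = M₂ - i'') ∧ 2 * i'' ≤ M₂ then (M₂.choose x : ℝ) *
          (if x ≤ K then κ * F₁ (K - x) + (2 * (x : ℝ) - M₂) * Mo₁ (K - x) else 0) else 0) ≤ 0 := by
      intro i'' hi''
      have hi''i : i'' < i := mem_range.mp hi''
      have hlt'' : 2 * i'' < M₂ := by omega
      have hiK'' : i'' ≤ K := by omega
      rw [Shells.shell_eq M₂ K κ F₁ Mo₁ n₁ j hN hFz hMoz hFsym hMoodd i'' hlt'' hiK'']
      have hVeq'' : ((M₂ : ℝ) - 2 * i'') = 2 * ((K - i'' : ℕ) : ℝ) + j - n₁ := by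
        have e : ((2 * K + j : ℕ) : ℝ) = ((n₁ + M₂ : ℕ) : ℝ) := by rw [hN]
        push_cast [Nat.cast_sub hiK''] at e ⊢
        linarith
      rw [hVeq'']
      have hv := hNP (K - i') hV hneg (K - i'') (by omega)
      exact mul_nonpos_of_nonneg_of_nonpos (by positivity) hv
    have htel := Shells.window_telescope M₂
      (fun x => if x ≤ K then κ * F₁ (K - x) + (2 * (x : ℝ) - M₂) * Mo₁ (K - x) else 0) i
    have hsum : ∑ i'' ∈ range i, ∑ x ∈ range (M₂ + 1),
        (if (x = i'' ∨ x = M₂ - i'') ∧ 2 * i'' ≤ M₂ then (M₂.choose x : ℝ) *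
          (if x ≤ K then κ * F₁ (K - x) + (2 * (x : ℝ) - M₂) * Mo₁ (K - x) else 0) else 0) ≤ 0 :=
      sum_nonpos hshells
    rw [htel] at htot
    linarith

/-- `LemmaS.lemma_S` with two-level monotonicity replaced by outward propagation of negativity:
if the untilted sum is nonnegative then so is the sum with any symmetric unimodal weight `v ≥ 0`. -/
theorem lemma_S' (n₁ j : ℕ) (hN : 2 * K + j = n₁ + M₂) (hκ : 0 ≤ κ)
    (hFz : ∀ k, n₁ < k → F₁ k = 0) (hFpos : ∀ k, k ≤ n₁ → 0 < F₁ k)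
    (hMoz : ∀ k, n₁ < k → Mo₁ k = 0)
    (hFsym : ∀ k, k ≤ n₁ → F₁ (n₁ - k) = F₁ k) (hMoodd : ∀ k, k ≤ n₁ → Mo₁ (n₁ - k) = -Mo₁ k)
    (hNP : ∀ b₀ : ℕ, (n₁ : ℝ) ≤ 2 * (b₀ : ℝ) + j →
      κ * (F₁ b₀ + F₁ (b₀ + j)) < (2 * (b₀ : ℝ) + j - n₁) * (Mo₁ b₀ + Mo₁ (b₀ + j)) →
      ∀ b, b₀ ≤ b → κ * (F₁ b + F₁ (b + j)) - (2 * (b : ℝ) + j - n₁) * (Mo₁ b + Mo₁ (b + j)) ≤ 0)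
    (htot : 0 ≤ ∑ x ∈ range (M₂ + 1), (M₂.choose x : ℝ) *
        (if x ≤ K then κ * F₁ (K - x) + (2 * (x : ℝ) - M₂) * Mo₁ (K - x) else 0))
    (v : ℕ → ℝ) (hvpos : ∀ x, 0 ≤ v x) (hvsym : ∀ x, x ≤ M₂ → v x = v (M₂ - x))
    (hvuni : ∀ x, 2 * x + 2 ≤ M₂ → v x ≤ v (x + 1)) :
    0 ≤ ∑ x ∈ range (M₂ + 1), (M₂.choose x : ℝ) * v x *
        (if x ≤ K then κ * F₁ (K - x) + (2 * (x : ℝ) - M₂) * Mo₁ (K - x) else 0) := by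
  set Φ : ℕ → ℝ := fun x => if x ≤ K then κ * F₁ (K - x) + (2 * (x : ℝ) - M₂) * Mo₁ (K - x) else 0
    with hΦ
  have htot' : 0 ≤ ∑ x ∈ range (M₂ + 1),
      (if 0 ≤ x ∧ x ≤ M₂ - 0 then (M₂.choose x : ℝ) * Φ x else 0) := by
    have e : ∑ x ∈ range (M₂ + 1), (if 0 ≤ x ∧ x ≤ M₂ - 0 then (M₂.choose x : ℝ) * Φ x else 0) =
        ∑ x ∈ range (M₂ + 1), (M₂.choose x : ℝ) * Φ x := by
      refine sum_congr rfl fun x hx => ?_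
      have : x ≤ M₂ := by
        have := mem_range.mp hx
        omega
      rw [if_pos ⟨Nat.zero_le x, by omega⟩]
    rw [e]
    exact htot
  have hW : ∀ i, 0 ≤ ∑ x ∈ range (M₂ + 1),
      (if i ≤ x ∧ x ≤ M₂ - i then (M₂.choose x : ℝ) * Φ x else 0) :=
    fun i => window_nonneg' M₂ K κ F₁ Mo₁ n₁ j hN hκ hFz hFpos hMoz hFsym hMoodd hNP htot' i
  have h := Shells.abel_window M₂ (fun x => (M₂.choose x : ℝ) * Φ x) hW (M₂ + 1) 0 (by omega) v
    (fun x _ _ => hvpos x) hvsym hvuni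
  have e : ∑ x ∈ range (M₂ + 1), (if 0 ≤ x ∧ x ≤ M₂ - 0 then (M₂.choose x : ℝ) * Φ x * v x else 0) =
      ∑ x ∈ range (M₂ + 1), (M₂.choose x : ℝ) * v x * Φ x := by
    refine sum_congr rfl fun x hx => ?_
    have : x ≤ M₂ := by
      have := mem_range.mp hx
      omega
    rw [if_pos ⟨Nat.zero_le x, by omega⟩]
    ring
  rw [e] at h
  exact h


end LemmaSNP

end Summit.CriticalPhenomena.PercolationContinuityZ3.Theorems
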